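import Summits.CriticalPhenomena.SAWScalingLimit.Theorems.ShellCrossingBound.Negative.Forcing2Lattice

/-!
# `ShellCrossingBound` — negative knowledge: forcing corridors (the uniform-threshold Aizenman–Burchard hypothesis is false for the critical SAW)

Part 3: the tail-to-room counting injection (`ncard_TS_lt`), identification of Smirnov's largest-component discrete domain with the room's component (`meshDomain_eq`), reachability in `Ω_δ` (`reachable_dd`).

Support file for crux `stmt-CriticalPhenomena-4728` (refuter `cdisprove`; work file
`Summits/CriticalPhenomena/SAWScalingLimit/Cruxes/ShellCrossingBound/Disproof.lean`; conclusion in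
`Negative/UniformThresholdFalse.lean`). Everything proved. [folklore]
-/

noncomputable section

open Set Filter Topology Metric MeasureTheory Complex
open scoped ENNReal Real
open Literature.Probability.RandomPlanarGeometry Literature.Probability.LatticeModels

namespace Summit.CriticalPhenomena.SAWScalingLimit.Theorems.ShellCrossingBound.Negative.Forcing

/-! ## D.1 Tail versus room: the room holds the unique largest component -/

/-- The column shift `N = ⌈x₀/δ⌉`. [folklore] -/
def Nsh (δ x₀ : ℝ) : ℤ := ⌈x₀ / δ⌉

/-- Room: mesh vertices to the right of `x₀`. [folklore] -/
def RS (δ x₀ : ℝ) : Set (Site 2) := {v | v ∈ meshVertices forcingDomain.carrier δ ∧ x₀ ≤ δ * v 0}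

/-- Tail: mesh vertices to the left of `x₀`. [folklore] -/
def TS (δ x₀ : ℝ) : Set (Site 2) := {v | v ∈ meshVertices forcingDomain.carrier δ ∧ δ * v 0 < x₀}

/-- The tail-to-room injection: shift `N` columns to the right, re-centred on the spine. [folklore] -/
def fsh (δ x₀ : ℝ) (v : Site 2) : Site 2 :=
  ![v 0 + Nsh δ x₀, v 1 - jsp δ (v 0) + jsp δ (v 0 + Nsh δ x₀)]

/-- A far spine point, in the room but beyond the image of the tail. [folklore] -/
def rfar (δ x₀ : ℝ) : Site 2 := ![2 * Nsh δ x₀, jsp δ (2 * Nsh δ x₀)]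

/-- The tail-to-room map is injective. [folklore] -/
theorem fsh_injective (δ x₀ : ℝ) : Function.Injective (fsh δ x₀) := by
  intro v w h
  have h0 := congrFun h 0
  have h1 := congrFun h 1
  simp only [fsh, Matrix.cons_val_zero, Matrix.cons_val_one] at h0 h1
  have hv0 : v 0 = w 0 := by linarith
  rw [hv0] at h1
  have hv1 : v 1 = w 1 := by linarith
  rw [eq_vec v, eq_vec w, hv0, hv1]

section Count

variable {δ x₀ : ℝ} (hg : Good δ x₀)
include hg

/-- The column shift covers `x₀` within one mesh: `x₀ ≤ δ N < x₀ + δ`. [folklore] -/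
theorem Nsh_bounds : x₀ ≤ δ * (Nsh δ x₀ : ℝ) ∧ δ * (Nsh δ x₀ : ℝ) < x₀ + δ := by
  have hδ := hg.hδ
  have h1 : x₀ / δ ≤ (Nsh δ x₀ : ℝ) := Int.le_ceil _
  have h2 : (Nsh δ x₀ : ℝ) < x₀ / δ + 1 := Int.ceil_lt_add_one _
  rw [div_le_iff₀ hδ] at h1
  have h2' : (Nsh δ x₀ : ℝ) * δ < (x₀ / δ + 1) * δ := mul_lt_mul_of_pos_right h2 hδ
  rw [add_mul, div_mul_cancel₀ _ hδ.ne', one_mul] at h2'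
  constructor <;> linarith

/-- A resolving mesh is smaller than `1/16`. [folklore] -/
theorem delta_lt : δ < 1 / 16 := by
  have := hg.hsmall; have := hg.hx₁; have := hg.hδ
  simp only [sl] at *
  linarith

/-- The tail-to-room map sends tail vertices into the room. [folklore] -/
theorem fsh_mem {v : Site 2} (hv : v ∈ TS δ x₀) : fsh δ x₀ v ∈ RS δ x₀ := by
  have hδ := hg.hδ
  have hs := sl_pos
  obtain ⟨hN1, hN2⟩ := Nsh_bounds hg
  obtain ⟨hvm, hvx⟩ := hv
  rw [eq_vec v] at hvm
  obtain ⟨hv1, hv2⟩ := (vec_mem_iff δ (v 0) (v 1)).1 hvm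
  have hv0 : 0 < δ * v 0 := re_pos_of_mem hvm
  have hx : x₀ ≤ δ * ((v 0 + Nsh δ x₀ : ℤ) : ℝ) := by push_cast; nlinarith
  refine ⟨?_, by simpa [fsh] using hx⟩
  simp only [fsh]
  rw [vec_mem_iff]
  refine ⟨?_, ?_⟩
  · have ha := abs_jsp hδ (v 0)
    have hb := abs_jsp hδ (v 0 + Nsh δ x₀)
    have hsm := hg.hsmall
    -- triangle inequality
    have key : |δ * ((v 1 - jsp δ (v 0) + jsp δ (v 0 + Nsh δ x₀) : ℤ) : ℝ) -
        ctr (δ * ((v 0 + Nsh δ x₀ : ℤ) : ℝ))| ≤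
        |δ * v 1 - ctr (δ * v 0)| + |δ * (jsp δ (v 0) : ℝ) - ctr (δ * v 0)| +
          |δ * (jsp δ (v 0 + Nsh δ x₀) : ℝ) - ctr (δ * ((v 0 + Nsh δ x₀ : ℤ) : ℝ))| := by
      have : δ * ((v 1 - jsp δ (v 0) + jsp δ (v 0 + Nsh δ x₀) : ℤ) : ℝ) -
          ctr (δ * ((v 0 + Nsh δ x₀ : ℤ) : ℝ)) =
          (δ * v 1 - ctr (δ * v 0)) - (δ * (jsp δ (v 0) : ℝ) - ctr (δ * v 0)) +
            (δ * (jsp δ (v 0 + Nsh δ x₀) : ℝ) - ctr (δ * ((v 0 + Nsh δ x₀ : ℤ) : ℝ))) := by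
        push_cast; ring
      rw [this]
      refine (abs_add_le _ _).trans ?_
      gcongr
      exact abs_sub _ _
    have hgoal : |δ * v 1 - ctr (δ * v 0)| + δ / 2 + δ / 2 < sl * (δ * ((v 0 + Nsh δ x₀ : ℤ) : ℝ)) := by
      push_cast
      nlinarith
    linarith
  · push_cast
    have := hg.hx₁
    have := delta_lt hg
    nlinarith

/-- The far spine point lies in the room. [folklore] -/
theorem rfar_mem : rfar δ x₀ ∈ RS δ x₀ := by
  have hδ := hg.hδ
  obtain ⟨hN1, hN2⟩ := Nsh_bounds hg
  have h14 := hg.hx₁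
  have hd := delta_lt hg
  have hx : x₀ ≤ δ * ((2 * Nsh δ x₀ : ℤ) : ℝ) := by push_cast; nlinarith [hg.hx₀]
  refine ⟨spine_mem hg hx ?_, by simpa [rfar] using hx⟩
  push_cast; nlinarith

/-- The far spine point is not in the image of the tail. [folklore] -/
theorem rfar_not_mem_image : rfar δ x₀ ∉ fsh δ x₀ '' TS δ x₀ := by
  rintro ⟨v, hv, hfv⟩
  have h0 := congrFun hfv 0
  simp only [fsh, rfar, Matrix.cons_val_zero] at h0
  have hv0 : v 0 = Nsh δ x₀ := by linarith
  obtain ⟨hN1, -⟩ := Nsh_bounds hg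
  have := hv.2
  rw [hv0] at this
  linarith

/-- The witness domain has finitely many mesh vertices. [folklore] -/
theorem finite_meshVertices : (meshVertices forcingDomain.carrier δ).Finite :=
  meshVertices_finite forcingDomain.isBounded hg.hδ

/-- The room is finite. [folklore] -/
theorem finite_RS : (RS δ x₀).Finite := (finite_meshVertices hg).subset fun _ hv => hv.1

/-- The tail is finite. [folklore] -/
theorem finite_TS : (TS δ x₀).Finite := (finite_meshVertices hg).subset fun _ hv => hv.1

/-- **The tail is smaller than the room.** [folklore] -/
theorem ncard_TS_lt : (TS δ x₀).ncard < (RS δ x₀).ncard := by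
  rw [← Set.ncard_image_of_injective (TS δ x₀) (fsh_injective δ x₀)]
  apply Set.ncard_lt_ncard _ (finite_RS hg)
  refine ⟨?_, fun h => rfar_not_mem_image hg (h (rfar_mem hg))⟩
  rintro _ ⟨v, hv, rfl⟩
  exact fsh_mem hg hv

/-! ## D.2 Identification of the discrete domain -/

/-- The main component: the component of the far spine point. [folklore] -/
def mainC : (meshVertexGraph forcingDomain.carrier δ).ConnectedComponent :=
  (meshVertexGraph forcingDomain.carrier δ).connectedComponentMk ⟨rfar δ x₀, (rfar_mem hg).1⟩

/-- The room lies in the main component. [folklore] -/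
theorem RS_subset_main : RS δ x₀ ⊆ Subtype.val '' (mainC hg).supp := by
  intro v hv
  refine ⟨⟨v, hv.1⟩, ?_, rfl⟩
  rw [SimpleGraph.ConnectedComponent.mem_supp_iff, mainC, SimpleGraph.ConnectedComponent.eq]
  have hr := rfar_mem hg
  obtain ⟨hu, hw, h⟩ := reach_of_le_of_le hg hv.1 hr.1 hv.2 (by simpa [rfar] using hr.2)
  exact h

/-- Every other component lies in the tail. [folklore] -/
theorem image_supp_subset_TS {C : (meshVertexGraph forcingDomain.carrier δ).ConnectedComponent}
    (hC : C ≠ mainC hg) : Subtype.val '' C.supp ⊆ TS δ x₀ := by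
  rintro _ ⟨v, hv, rfl⟩
  refine ⟨v.2, ?_⟩
  by_contra hlt
  rw [not_lt] at hlt
  have hmain := RS_subset_main hg ⟨v.2, hlt⟩
  obtain ⟨w, hw, hwv⟩ := hmain
  have hwv' : w = v := Subtype.ext hwv
  subst hwv'
  rw [SimpleGraph.ConnectedComponent.mem_supp_iff] at hv hw
  exact hC (hv.symm.trans hw)

/-- Every other component is strictly smaller than the main component. [folklore] -/
theorem ncard_supp_lt {C : (meshVertexGraph forcingDomain.carrier δ).ConnectedComponent}
    (hC : C ≠ mainC hg) : C.supp.ncard < (mainC hg).supp.ncard := by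
  have h1 : C.supp.ncard = (Subtype.val '' C.supp).ncard :=
    (Set.ncard_image_of_injective _ Subtype.val_injective).symm
  have h2 : (mainC hg).supp.ncard = (Subtype.val '' (mainC hg).supp).ncard :=
    (Set.ncard_image_of_injective _ Subtype.val_injective).symm
  rw [h1, h2]
  have hfin : (Subtype.val '' (mainC hg).supp).Finite :=
    (finite_meshVertices hg).subset (by rintro _ ⟨v, -, rfl⟩; exact v.2)
  calc (Subtype.val '' C.supp).ncard ≤ (TS δ x₀).ncard :=
        Set.ncard_le_ncard (image_supp_subset_TS hg hC) (finite_TS hg)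
    _ < (RS δ x₀).ncard := ncard_TS_lt hg
    _ ≤ (Subtype.val '' (mainC hg).supp).ncard := Set.ncard_le_ncard (RS_subset_main hg) hfin

/-- The main component has maximal size. [folklore] -/
theorem main_max (C : (meshVertexGraph forcingDomain.carrier δ).ConnectedComponent) :
    C.supp.ncard ≤ (mainC hg).supp.ncard := by
  by_cases hC : C = mainC hg
  · rw [hC]
  · exact (ncard_supp_lt hg hC).le

/-- **The discrete domain `Ω_δ` is the main component** (Smirnov's largest-component convention,
settled by counting). [folklore] -/
theorem meshDomain_eq : meshDomain forcingDomain.carrier δ = Subtype.val '' (mainC hg).supp := by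
  apply Subset.antisymm
  · intro x hx
    simp only [meshDomain, mem_iUnion] at hx
    obtain ⟨C, hC, hx⟩ := hx
    have hCm : C = mainC hg := by
      by_contra hne
      have h1 := ncard_supp_lt hg hne
      have h2 := hC (mainC hg)
      omega
    rw [← hCm]; exact hx
  · intro x hx
    simp only [meshDomain, mem_iUnion]
    exact ⟨mainC hg, main_max hg, hx⟩

/-- The room lies in the discrete domain `Ω_δ`. [folklore] -/
theorem RS_subset_meshDomain : RS δ x₀ ⊆ meshDomain forcingDomain.carrier δ := by
  rw [meshDomain_eq hg]; exact RS_subset_main hg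

/-- A walk of the mesh vertex graph starting in the main component maps to the graph `Ω_δ`. [folklore] -/
theorem reachable_dd_of_walk {u v : meshVertices forcingDomain.carrier δ}
    (p : (meshVertexGraph forcingDomain.carrier δ).Walk u v) (hu : u ∈ (mainC hg).supp) :
    (discreteDomainGraph forcingDomain.carrier δ).Reachable u.1 v.1 := by
  induction p with
  | nil => exact SimpleGraph.Reachable.refl _
  | @cons a b c hadj p ih =>
    have hb : b ∈ (mainC hg).supp := by
      rw [SimpleGraph.ConnectedComponent.mem_supp_iff] at hu ⊢
      rw [← hu]
      exact (SimpleGraph.ConnectedComponent.eq.2 hadj.reachable).symm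
    have hdom : ∀ w : meshVertices forcingDomain.carrier δ, w ∈ (mainC hg).supp →
        w.1 ∈ meshDomain forcingDomain.carrier δ := fun w hw => by
      rw [meshDomain_eq hg]; exact ⟨w, hw, rfl⟩
    have hadj' : (discreteDomainGraph forcingDomain.carrier δ).Adj a.1 b.1 := by
      rw [discreteDomainGraph_adj_iff]
      refine ⟨?_, hdom a hu, hdom b hb⟩
      simpa [SimpleGraph.comap_adj] using hadj
    exact hadj'.reachable.trans (ih hb)

/-- **Room points are joined in `Ω_δ`.** [folklore] -/
theorem reachable_dd {u v : Site 2} (hu : u ∈ RS δ x₀) (hv : v ∈ RS δ x₀) :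
    (discreteDomainGraph forcingDomain.carrier δ).Reachable u v := by
  obtain ⟨hu', hv', h⟩ := reach_of_le_of_le hg hu.1 hv.1 hu.2 hv.2
  obtain ⟨p⟩ := h
  have humain : (⟨u, hu'⟩ : meshVertices forcingDomain.carrier δ) ∈ (mainC hg).supp := by
    obtain ⟨w, hw, hwu⟩ := RS_subset_main hg hu
    have : w = ⟨u, hu'⟩ := Subtype.ext hwu
    rw [← this]; exact hw
  exact reachable_dd_of_walk hg p humain

end Count

end Summit.CriticalPhenomena.SAWScalingLimit.Theorems.ShellCrossingBound.Negative.Forcing
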